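import Summits.QuantumFields.YangMills.Theorems.BalabanUVNodesN07Thm4RecordStructureSym152
import HarnessLib
/-!
# N07 [B11] (= [15] = [Balaban1985Variational]) Sect. F — **THE PREMISE OF RECORD UNDER A3⁵ ∕ №311a (β): `HThm4RecSym152Phi`, THE φ-b₂ EDITION OF ✓p741711 `HThm4RecSym152`** —
# rows 1–8 of 88″ and print's (152) second member (T2b) VERBATIM; row 9′ := `NrmSymPhiOfRecord F N Mc ρ ψ … u A` = MODULE 87's `NrmSymOfRecord` with the exact normalisation «`R̄^{j′}g = 1`»
# relaxed to «`‖R̄^{j′}g(y) − 1‖ ≤ ψ`» at every cell, `g = h̄·w·u⁻¹` UNCHANGED (no extra factor), `ψ` ONE DISPLAYED real per premise (the junction supplies the second-order defect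
# `ψ := ψ₂ = C·θ_j·κε_j` of the (B′) road; `ψ = 0` ⇔ the exact edition); the door to 77c⁗'s HS3NORM clause at `Nrm := NrmSymPhiOfRecord F N Mc ρ ψ`; monotonicity; exact ⇒ φ; A6

Cell `pub-ymgap`, seat `pub-ymgap-dag-n07-e` g30 (FAN-OUT §N07 row s3; LANE OWNER of the K0 road chart side) — (c-ii)′ per plan g93 ■ CORRECTION (β) I.30498 and the chart reader's shape
precision I.30524 (the defect sits on the ACTUAL delivered `u`; a displayed cell-constant factor would twist the representative's coarse gauge at first order).  `--kind definition --supports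
stmt-QuantumFields-20541 --as helper` (K0⁷); count-neutral.  TWO `def`s (displayed premises, NEVER asserted) + bookkeeping theorems.  [15] = [Balaban1985Variational];
[6] = [Balaban1985RegularSpaces]; [3] = [Balaban1985Averaging]; [I] = [Balaban1987RG1].

WHY.  Director №311a ∕ plan (β): the (B′) road («axiality-preserving pre-composition of the Thm-4 input by block-constant lifts, no contraction») delivers an EXACT Landau gauge `u` of the
minimiser (rows 1–8 + (T2b) verbatim) whose normalisation in the averaged-contour currency holds up to the SECOND-ORDER cross term `ψ₂` (n05-e I.30497; plan I.30498), not exactly.  The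
chart's reader (MODULE 93′ `dbar_eq_conj_eml_twist`) carries `ρ̄ := R̄^{l}(h̄·w·u⁻¹)` displayed and pays `‖ρ̄ − 1‖ ≤ ψ` at each bond end, an ε²-type addition to the near rows ((Q-ψ₂) YES,
I.30471) — PROVIDED the defect is stated for the actual map `h̄·w·u⁻¹`, which this file does.

WHAT IS DECLARED ∕ PROVED (sorry-free; axioms standard).
* §1 `NrmSymPhiOfRecord F N Mc ρ ψ` (87's text with «`= 1`» ↦ «`‖· − 1‖ ≤ ψ`»); `NrmSymPhiOfRecord.of_exact` (`0 ≤ ψ`: exact ⇒ φ), `NrmSymPhiOfRecord.mono` (in `ψ`).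
* §2 `HThm4RecSym152Phi F N Mc ρ κ a₀ ψ` (✓p741711's body with row 9′ := §1); `hThm4RecSym152Phi_of_exact`, `hThm4RecSym152Phi_mono` (κ up, a₀ down, ψ up).
* §3 ★★★ `hS3NORMSym152Phi_of_hThm4RecSym152Phi` — THE DOOR: 77c⁗'s HS3NORM-152 clause at `Nrm := NrmSymPhiOfRecord F N Mc ρ ψ` (88″'s door byte for byte).
* §4 A6: `nrmSymPhiOfRecord_one`, `hThm4RecSym152Phi_conclusion_at_one` (from the exact certificates of ✓p741711).
HONEST LABEL (binding).  `HThm4RecSym152Phi` is a CONDITIONAL premise (N05's (B′) road + the cross-term bound (B′-5)′, elementary but not yet typed; licence per №310∕№311: variant, our proof);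
this file DISCHARGES NOTHING of it; K0⁷ ∕ K1⁹ NOT closed; N07 ∕ N05 NOT discharged; counts unmoved (typed 28∕28 · discharged 8∕28); one finite 𝕋⁴ programme at fixed ε — the route closes the
conditional finite-𝕋⁴ rung `BalabanLadder.UV` ONLY; the YM mass gap (Clay) is NOT proved by any of this; nothing continuum ∕ ℝ⁴ ∕ OS.  TWO `def`s, no `instance`, no `notation`, no `sorry`.

References: [6] Thm. 4 p. 88, Prop. 6 (1.130)–(1.138) p. 99, (1.29) p. 81; [15] (144) p. 300, (147)–(153) p. 301; [3] (78)–(81) p. 30; [I] (0.4)–(0.11) pp. 253–254.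
-/

set_option autoImplicit false

noncomputable section
open scoped BigOperators Matrix.Norms.L2Operator

namespace Summit.QuantumFields.YangMills.BalabanUVNodes.N07Thm4RecordStructureSym152Phi

open Literature.MathematicalPhysics.QuantumFieldTheory.Balaban1983to89
open Literature.MathematicalPhysics.QuantumFieldTheory.Balaban1983to89.Node00
open Literature.MathematicalPhysics.QuantumFieldTheory.Balaban1983to89.B15DeterminingSets
open Literature.MathematicalPhysics.QuantumFieldTheory.Balaban1983to89.B12RegularSpaces111 (gaugeU expI grad)
open B15Eq112TorusCover (cover)
open B14DomainGeom (Pt Within)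
open B8Eq131Cubes (sqLo sqHi box cube)
open B5Eq118OneStroke (iterBlockOf)
open B6SectADomainsV1 (Domains)
open B6SectAOperatorsV1 (BondIdx RE dsE QpE)
open Literature.MathematicalPhysics.QuantumFieldTheory.BalabanImbrieJaffe1984to88.BIJ85AxialPropagator411 (BondSpace)
open T4Continuum (T4Family)
open Summit.QuantumFields.YangMills.BalabanUVNodes.N07NormalisationSymOfRecord (NrmSymOfRecord symCd)
open Summit.QuantumFields.YangMills.BalabanUVNodes.N07Thm4RecordStructureSym152 (HThm4RecSym152 nrmSymOfRecord_one hThm4RecSym152_conclusion_at_one)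
open Summit.QuantumFields.YangMills.BalabanUVNodes.N07DatumGauge152Guarded (two_mul_pow_le_sitesPerDir_of_levelGuard)
open Summit.QuantumFields.YangMills.BalabanUVNodes.N07Thm4RecordStructure (axialGaugeAt_one gaugeAct_one_one)
open Summit.QuantumFields.YangMills.BalabanUVNodes.N07SymContourData (axialGauge_symContourData_one)
open T4AxialGaugeRooted (axialGaugeAt)
open B15Eq177GaugeInvariance (blockLift)
open B12GaugeOrbits021 (IsResidual)
open GaugeField (gaugeAct)
open ExpMeanLog (expMeanLogSU)
open B8Eq131Cubes (tLo tHi ctr)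

variable (F : T4Family) (N : ℕ) [NeZero N]

/-! ## §1  Row 9′ up to a displayed defect: `NrmSymPhiOfRecord` -/

/-- **THE NORMALISATION OF RECORD IN THE SYMMETRIC CURRENCY, UP TO A DISPLAYED DEFECT `ψ`** — MODULE 87's `NrmSymOfRecord` VERBATIM except that the exact normalisation «`R̄^{j′}g(y) = 1`» of
`g = h̄·w·u⁻¹` at the cell sites of `D″` is relaxed to «`‖R̄^{j′}g(y) − 1‖ ≤ ψ`» (operator norm in `M_N(ℂ)`); the map `g` is UNCHANGED (no extra factor).  Of record under №311a (β): the (B′) road's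
Landau gauge is normalised in the averaged-contour currency up to the second-order cross term `ψ₂`.  A displayed predicate, NEVER asserted.
[cite: Balaban1987RG1, (0.11) p.253; Balaban1985Variational, (144) p.300, (147) p.301, (150)–(154) pp.301–302; Balaban1985Averaging, (78)–(81) p.30; Balaban1985RegularSpaces, (1.29) p.81] -/
def NrmSymPhiOfRecord (Mc ρ : ℕ) (ψ : ℝ) :
    ∀ (ν : Stage7Numerics) (M : ℕ) (g : ℕ → ℝ) (K k : ℕ), SeqOfRecord F ν M g K k → GaugeField (F.P K) 0 (SU N) → ℕ → Pt (F.P K).d →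
      GaugeTransf (F.P K) 0 (SU N) → (PBond (F.P K) 0 → MatA N) → Prop :=
  fun _ν _M _g K _k s U j idx u _A =>
    ∃ w : GaugeTransf (F.P K) 0 (SU N), IsResidual j w ∧
      (∀ i < j, AxialGauge (symCd F N K i) (Averaging.iter (avOfRecord F N K) i (gaugeAct w U))) ∧
      ∀ (hk : j ≤ (F.P K).m + (F.P K).K) (j' : ℕ), j' ≤ j → ∀ y : Site (F.P K) j',
        (domainsMeet (cubeDomains (F.P K) (cornerP (F.P K) Mc ρ idx) (sideP (F.P K) Mc ρ) ρ j hk) (domainsOfSeq s.Ω j hk)).LamSite j' y →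
          ‖((gaugeAvgIter (loopAvgBlockOp expMeanLogSU)
              (fun x => blockLift j (axialGaugeAt (Averaging.iter (avOfRecord F N K) j (gaugeAct w U))
                  (tLo (cornerP (F.P K) Mc ρ idx) ρ) (tHi (cornerP (F.P K) Mc ρ idx) (sideP (F.P K) Mc ρ) ρ) (ctr (cornerP (F.P K) Mc ρ idx) (sideP (F.P K) Mc ρ))) x *
                w x * (u x)⁻¹) j' y : SU N) : Matrix (Fin N) (Fin N) ℂ) - 1‖ ≤ ψ

variable {F N}

/-- The exact normalisation implies the φ-edition for every `ψ ≥ 0`. [cite: Balaban1985Averaging, (81) p.30 (bookkeeping)] -/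
theorem NrmSymPhiOfRecord.of_exact {Mc ρ : ℕ} {ψ : ℝ} (hψ : 0 ≤ ψ) {ν : Stage7Numerics} {M : ℕ} {g : ℕ → ℝ} {K k : ℕ} {s : SeqOfRecord F ν M g K k}
    {U : GaugeField (F.P K) 0 (SU N)} {j : ℕ} {idx : Pt (F.P K).d} {u : GaugeTransf (F.P K) 0 (SU N)} {A : PBond (F.P K) 0 → MatA N}
    (h : NrmSymOfRecord F N Mc ρ ν M g K k s U j idx u A) : NrmSymPhiOfRecord F N Mc ρ ψ ν M g K k s U j idx u A := by
  obtain ⟨w, hres, hax, hnorm⟩ := h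
  refine ⟨w, hres, hax, fun hk j' hj' y hy => ?_⟩
  rw [hnorm hk j' hj' y hy, OneMemClass.coe_one, sub_self, norm_zero]
  exact hψ

/-- Monotonicity in the defect. [cite: Balaban1985Averaging, (81) p.30 (bookkeeping)] -/
theorem NrmSymPhiOfRecord.mono {Mc ρ : ℕ} {ψ ψ' : ℝ} (hψ : ψ ≤ ψ') {ν : Stage7Numerics} {M : ℕ} {g : ℕ → ℝ} {K k : ℕ} {s : SeqOfRecord F ν M g K k}
    {U : GaugeField (F.P K) 0 (SU N)} {j : ℕ} {idx : Pt (F.P K).d} {u : GaugeTransf (F.P K) 0 (SU N)} {A : PBond (F.P K) 0 → MatA N}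
    (h : NrmSymPhiOfRecord F N Mc ρ ψ ν M g K k s U j idx u A) : NrmSymPhiOfRecord F N Mc ρ ψ' ν M g K k s U j idx u A := by
  obtain ⟨w, hres, hax, hnorm⟩ := h
  exact ⟨w, hres, hax, fun hk j' hj' y hy => (hnorm hk j' hj' y hy).trans hψ⟩

variable (F N)

/-! ## §2  The named premise, (152)-complete on the tower, row 9′ up to `ψ` -/


/-- **`HThm4RecSym152Phi` — THE φ-b₂ EDITION OF `HThm4RecSym152`**: [6] Theorem 4 ∕ Proposition 6 with [15] (152)–(153) (first AND second member of (152) on the whole tower), at every meeting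
datum of a separated run — ✓p741711's rows 1–8 + (T2b) VERBATIM — and row 9′ := §1's `NrmSymPhiOfRecord … ψ … u A` («ū_j = 1 on Λ′_j» in the averaged-contour currency UP TO the displayed
defect `ψ`).  A displayed premise, NEVER asserted (print-licensed [I] pp. 253–254 for the (0.4)∕(0.11) structure; (B′) road = variant, our proof). [cite: Balaban1985RegularSpaces, Thm. 4 p.88, Prop. 6 (1.130)–(1.138) p.99, (1.29) p.81; Balaban1985Variational, (147)–(153) p.301; Balaban1985Averaging, (78)–(81) p.30; Balaban1987RG1, (0.4)–(0.9) pp.253–254] -/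
def HThm4RecSym152Phi (Mc ρ : ℕ) (κ a₀ ψ : ℝ) : Prop :=
  0 < κ → ∀ (ν : Stage7Numerics) (M : ℕ) (g : ℕ → ℝ) (K k : ℕ) (s : SeqOfRecord F ν M g K k), Sect2.SeqSeparated ν.M₁ s → 0 < ν.M₁ →
    (11 * 4 + 4 * ρ + Mc + 3) * F.L ≤ ν.M₁ → Mc + 11 * 4 + 6 * ρ ≤ (F.P K).sitesPerDir k → 1 ≤ k →
    ∀ (ε : ℕ → ℝ), (∀ n, n ≤ k → 0 < ε n ∧ ε n ≤ a₀) → (∀ n, n < k → ε n ≤ 2 * ε (n + 1)) →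
    ∀ U : GaugeField (F.P K) 0 (SU N),
    (∀ n, n ≤ k → PlaqSmallOn (Sect2.omegaPlaqsTop s.Ω (suppDomOfRecord F ν K s.Ω) n) (ε n * (F.P K).eta n ^ 2) U) →
    (∀ n, n ≤ k → Sect2.CoDivSmallOn (Sect2.omegaBondsTop s.Ω (suppDomOfRecord F ν K s.Ω) n) (ε n * (F.P K).eta n ^ 3) U) →
    ∀ (j : ℕ) (hk : j ≤ (F.P K).m + (F.P K).K), 1 ≤ j → j ≤ k → ∀ (idx : Pt (F.P K).d),
    (∃ x ∈ box (F.P K).L (cornerP (F.P K) Mc ρ idx) (sideP (F.P K) Mc ρ) j, ∃ y : Pt (F.P K).d, cover (F.P K) y ∈ s.Ω j ∧ Within ((3 : ℕ) : ℤ) x y) →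
    ∃ (u : GaugeTransf (F.P K) 0 (SU N)) (A : PBond (F.P K) 0 → MatA N),
      (∀ b ∈ (Sect2.regionOfSet (F.P K) (cover (F.P K) '' box (F.P K).L (cornerP (F.P K) Mc ρ idx) (sideP (F.P K) Mc ρ) j)).bonds,
        gaugeU (fun x => ιSU N (u x)) (fun b' => ιSU N (U b')) b = expI ((F.P K).eta j) (A b)) ∧
      (∀ b ∈ (Sect2.regionOfSet (F.P K) (cover (F.P K) '' cube (F.P K).L (cornerP (F.P K) Mc ρ idx) (sideP (F.P K) Mc ρ) ρ j 0)).bonds,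
        gaugeU (fun x => ιSU N (u x)) (fun b' => ιSU N (U b')) b = expI ((F.P K).eta j) (A b)) ∧
      (∀ j', j' ≤ j →
        ∀ b ∈ (Sect2.regionOfSet (F.P K) (cover (F.P K) '' cube (F.P K).L (cornerP (F.P K) Mc ρ idx) (sideP (F.P K) Mc ρ) ρ j j')).bonds,
          ‖A b‖ < κ * ε j * ((F.P K).L : ℝ) ^ (j - j')) ∧
      -- ★ (T2b): print's (152) SECOND member on the tower
      (∀ j', j' ≤ j →
        ∀ q ∈ (Sect2.regionOfSet (F.P K) (cover (F.P K) '' cube (F.P K).L (cornerP (F.P K) Mc ρ idx) (sideP (F.P K) Mc ρ) ρ j j')).dpairs,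
          ‖grad ((F.P K).eta j) q.2.1 (fun y => A ⟨y, q.2.2⟩) q.1‖ < κ * ε j * ((F.P K).L : ℝ) ^ (2 * (j - j'))) ∧
      (∀ b ∈ (Sect2.regionOfSet (F.P K) (cover (F.P K) '' box (F.P K).L (cornerP (F.P K) Mc ρ idx) (sideP (F.P K) Mc ρ) j)).bonds,
        ‖A b‖ < κ * ε j) ∧
      (∀ q ∈ (Sect2.regionOfSet (F.P K) (cover (F.P K) '' box (F.P K).L (cornerP (F.P K) Mc ρ idx) (sideP (F.P K) Mc ρ) j)).dpairs,
        ‖grad ((F.P K).eta j) q.2.1 (fun y => A ⟨y, q.2.2⟩) q.1‖ < κ * ε j) ∧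
      (∀ b ∈ Sect2.bondsDeep (cover (F.P K) '' box (F.P K).L (cornerP (F.P K) Mc ρ idx) (sideP (F.P K) Mc ρ) j),
        ‖Sect2.codiffCurlA ((F.P K).eta j) A b.src b.dir‖ < κ * ε j) ∧
      (∀ b ∈ Sect2.bondsDeep (cover (F.P K) '' box (F.P K).L (cornerP (F.P K) Mc ρ idx) (sideP (F.P K) Mc ρ) j),
        ‖∑ ν' : Fin (F.P K).d, (((F.P K).eta j : ℝ) : ℂ)⁻¹ •
            (grad ((F.P K).eta j) ν' (fun y => A ⟨y, b.dir⟩) (b.src.unshift ν') - grad ((F.P K).eta j) ν' (fun y => A ⟨y, b.dir⟩) b.src)‖ < κ * ε j) ∧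
      (∀ φ : MatA N →L[ℂ] ℂ,
        RE (domainsMeet (cubeDomains (F.P K) (cornerP (F.P K) Mc ρ idx) (sideP (F.P K) Mc ρ) ρ j hk) (domainsOfSeq s.Ω j hk)) ((F.P K).eta j)⁻¹
            (dsE ((F.P K).eta j)⁻¹ (WithLp.toLp 2 fun b => (φ (A b)).re : BondSpace (F.P K))) = 0 ∧
        RE (domainsMeet (cubeDomains (F.P K) (cornerP (F.P K) Mc ρ idx) (sideP (F.P K) Mc ρ) ρ j hk) (domainsOfSeq s.Ω j hk)) ((F.P K).eta j)⁻¹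
            (dsE ((F.P K).eta j)⁻¹ (WithLp.toLp 2 fun b => (φ (A b)).im : BondSpace (F.P K))) = 0) ∧
      NrmSymPhiOfRecord F N Mc ρ ψ ν M g K k s U j idx u A

variable {F N}

/-- The exact edition implies the φ-edition for every `ψ ≥ 0`. [cite: Balaban1985Variational, (152) p.301 (bookkeeping)] -/
theorem hThm4RecSym152Phi_of_exact {Mc ρ : ℕ} {κ a₀ ψ : ℝ} (hψ : 0 ≤ ψ) (h : HThm4RecSym152 F N Mc ρ κ a₀) : HThm4RecSym152Phi F N Mc ρ κ a₀ ψ := by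
  intro h0 ν M g K k s hsep hM₁ hfl hnw hk ε hε hcomp U h17 h19 j hk' hj1 hjk idx hmeet
  obtain ⟨u, A, h1, hT1, hT2, hT2b, h2, h3, h4, h5, h6, hN⟩ :=
    h h0 ν M g K k s hsep hM₁ hfl hnw hk ε hε hcomp U h17 h19 j hk' hj1 hjk idx hmeet
  exact ⟨u, A, h1, hT1, hT2, hT2b, h2, h3, h4, h5, h6, NrmSymPhiOfRecord.of_exact hψ hN⟩

/-- **MONOTONICITY OF THE φ-EDITION**: for `0 < κ ≤ κ′`, `a₀′ ≤ a₀`, `ψ ≤ ψ′`: `HThm4RecSym152Phi F N Mc ρ κ a₀ ψ → HThm4RecSym152Phi F N Mc ρ κ′ a₀′ ψ′`.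
[cite: Balaban1985RegularSpaces, Prop. 6 p.99; Balaban1985Variational, (152) p.301] -/
theorem hThm4RecSym152Phi_mono {Mc ρ : ℕ} {κ κ' a₀ a₀' ψ ψ' : ℝ} (h0 : 0 < κ) (hκ : κ ≤ κ') (ha : a₀' ≤ a₀) (hψ : ψ ≤ ψ') (h : HThm4RecSym152Phi F N Mc ρ κ a₀ ψ) :
    HThm4RecSym152Phi F N Mc ρ κ' a₀' ψ' := by
  intro _ ν M g K k s hsep hM₁ hfl hnw hk ε hε hcomp U h17 h19 j hk' hj1 hjk idx hmeet
  have hε' : ∀ n, n ≤ k → 0 < ε n ∧ ε n ≤ a₀ := fun n hn => ⟨(hε n hn).1, (hε n hn).2.trans ha⟩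
  obtain ⟨u, A, h1, hT1, hT2, hT2b, h2, h3, h4, h5, h6, hN⟩ :=
    h h0 ν M g K k s hsep hM₁ hfl hnw hk ε hε' hcomp U h17 h19 j hk' hj1 hjk idx hmeet
  have hεj : 0 ≤ ε j := (hε j hjk).1.le
  have hκε : κ * ε j ≤ κ' * ε j := mul_le_mul_of_nonneg_right hκ hεj
  refine ⟨u, A, h1, hT1, ?_, ?_, ?_, ?_, ?_, ?_, h6, hN.mono hψ⟩
  · intro j' hj' b hb
    exact (hT2 j' hj' b hb).trans_le (mul_le_mul_of_nonneg_right hκε (pow_nonneg (Nat.cast_nonneg _) _))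
  · intro j' hj' q hq
    exact (hT2b j' hj' q hq).trans_le (mul_le_mul_of_nonneg_right hκε (pow_nonneg (Nat.cast_nonneg _) _))
  · intro b hb; exact (h2 b hb).trans_le hκε
  · intro q hq; exact (h3 q hq).trans_le hκε
  · intro b hb; exact (h4 b hb).trans_le hκε
  · intro b hb; exact (h5 b hb).trans_le hκε

/-! ## §3  The door: the (152)-complete HS3NORM clause at `Nrm := NrmSymPhiOfRecord … ψ` -/

variable (F N)

/-- ★★★ **THE CONDITIONAL DOOR S1ᶜ, (152)-COMPLETE**: from `HThm4RecSym152 F N Mc ρ κ a₀` and the knit's guard implication `Adm … → c ≤ ν.M₁ ∧ k + c₀ ≤ F.m + K` with the side conditions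
`(11·4 + 4ρ + Mc + 3)·L ≤ c`, `Mc + 11·4 + 6ρ ≤ 2·L^{c₀}`, `0 < B₃`, `0 < κ` — the HS3NORM-67c clause of the knit AT `Nrm := NrmSymOfRecord F N Mc ρ` WITH (T2b) after the tower's sup
letters (the HS3NORM binder of the 152-edition of the knit).  MODULE 88″'s door byte for byte, plus the one conjunct; the (153) rows are extended to every `D′` with
`ker Q′_{D′} ≤ ker Q′_{D″}` as there. [cite: Balaban1985Variational, (144) p.300, (147)–(153) p.301; Balaban1985RegularSpaces, Prop. 6 p.99, Thm. 4 p.88, (1.29) p.81; Balaban1987RG1, (0.1) p.251, (0.4) p.253] -/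
theorem hS3NORMSym152Phi_of_hThm4RecSym152Phi {ρ Mc : ℕ} {c c₀ : ℕ} (hc : (11 * 4 + 4 * ρ + Mc + 3) * F.L ≤ c) (hc₀ : Mc + 11 * 4 + 6 * ρ ≤ 2 * F.L ^ c₀)
    (Adm : StepGuard F) (hAdm : ∀ (ν : Stage7Numerics) (M : ℕ) (g : ℕ → ℝ) (K k : ℕ) (s : SeqOfRecord F ν M g K k), Adm ν M g K k s → c ≤ ν.M₁ ∧ k + c₀ ≤ F.m + K)
    {B₃ κ a₀ a₁ : ℝ} (hB₃ : 0 < B₃) (hκ : 0 < κ) {ψ : ℝ} (hT : HThm4RecSym152Phi F N Mc ρ κ a₀ ψ) :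
    ∀ (ν : Stage7Numerics) (M : ℕ) (g : ℕ → ℝ) (K k : ℕ) (s : SeqOfRecord F ν M g K k), Sect2.SeqSeparated ν.M₁ s → 0 < ν.M₁ →
      Adm ν M g K k s → 1 ≤ k →
      ∀ (ε δ : ℕ → ℝ),
      (∀ n, n ≤ k → 0 < δ n ∧ δ n ≤ a₁) → (∀ n, n < k → δ n ≤ 2 * δ (n + 1)) → (∀ n, n < k → δ (n + 1) ≤ 2 * δ n) →
      (∀ n, n ≤ k → B₃ * δ n ≤ ε n ∧ ε n ≤ a₀) → (∀ n, n < k → ε n ≤ 2 * ε (n + 1)) → (∀ n, n < k → ε (n + 1) ≤ 2 * ε n) →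
      ∀ W : MSField (F.P K) (SU N), Sect2.DataSmall7PTop (avOfRecord F N K) s.Ω (suppDomOfRecord F ν K s.Ω) k δ W →
      ∀ U : GaugeField (F.P K) 0 (SU N),
      (∀ n, n ≤ k → PlaqSmallOn (Sect2.omegaPlaqsTop s.Ω (suppDomOfRecord F ν K s.Ω) n) (ε n * (F.P K).eta n ^ 2) U) →
      (∀ n, n ≤ k → Sect2.CoDivSmallOn (Sect2.omegaBondsTop s.Ω (suppDomOfRecord F ν K s.Ω) n) (ε n * (F.P K).eta n ^ 3) U) →
      AgreeOn (genSet s.Ω k) (avgFamily (avOfRecord F N K) U) W → IsCritOnFibre F N K (genSet s.Ω k) W U →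
      ∀ (n : ℕ) (hk : K - n ≤ (F.P K).m + (F.P K).K), 1 ≤ K - n → K - n ≤ k → ∀ (idx : Pt (F.P K).d),
      (∃ x ∈ box (F.P K).L (cornerP (F.P K) Mc ρ idx) (sideP (F.P K) Mc ρ) (K - n), ∃ y : Pt (F.P K).d, cover (F.P K) y ∈ s.Ω (K - n) ∧ Within ((3 : ℕ) : ℤ) x y) →
      (K - n = k ∨ ∀ z ∈ box (F.P K).L (cornerP (F.P K) Mc ρ idx - ((2 * ρ : ℕ) : Pt (F.P K).d)) (sideP (F.P K) Mc ρ + 2 * (2 * ρ)) (K - n),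
        cover (F.P K) z ∉ s.Ω (K - n + 1)) →
      ∃ (u : GaugeTransf (F.P K) 0 (SU N)) (A : PBond (F.P K) 0 → MatA N),
      (∀ b ∈ (Sect2.regionOfSet (F.P K) (cover (F.P K) '' box (F.P K).L (cornerP (F.P K) Mc ρ idx) (sideP (F.P K) Mc ρ) (K - n))).bonds,
        gaugeU (fun x => ιSU N (u x)) (fun b' => ιSU N (U b')) b = expI ((F.P K).eta (K - n)) (A b)) ∧
      (∀ b ∈ (Sect2.regionOfSet (F.P K) (cover (F.P K) '' cube (F.P K).L (cornerP (F.P K) Mc ρ idx) (sideP (F.P K) Mc ρ) ρ (K - n) 0)).bonds,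
        gaugeU (fun x => ιSU N (u x)) (fun b' => ιSU N (U b')) b = expI ((F.P K).eta (K - n)) (A b)) ∧
      (∀ j', j' ≤ K - n →
        ∀ b ∈ (Sect2.regionOfSet (F.P K) (cover (F.P K) '' cube (F.P K).L (cornerP (F.P K) Mc ρ idx) (sideP (F.P K) Mc ρ) ρ (K - n) j')).bonds,
          ‖A b‖ < κ * ε (K - n) * ((F.P K).L : ℝ) ^ (K - n - j')) ∧
      (∀ j', j' ≤ K - n →
        ∀ q ∈ (Sect2.regionOfSet (F.P K) (cover (F.P K) '' cube (F.P K).L (cornerP (F.P K) Mc ρ idx) (sideP (F.P K) Mc ρ) ρ (K - n) j')).dpairs,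
          ‖grad ((F.P K).eta (K - n)) q.2.1 (fun y => A ⟨y, q.2.2⟩) q.1‖ < κ * ε (K - n) * ((F.P K).L : ℝ) ^ (2 * (K - n - j'))) ∧
      (∀ b ∈ (Sect2.regionOfSet (F.P K) (cover (F.P K) '' box (F.P K).L (cornerP (F.P K) Mc ρ idx) (sideP (F.P K) Mc ρ) (K - n))).bonds,
        ‖A b‖ < κ * ε (K - n)) ∧
      (∀ q ∈ (Sect2.regionOfSet (F.P K) (cover (F.P K) '' box (F.P K).L (cornerP (F.P K) Mc ρ idx) (sideP (F.P K) Mc ρ) (K - n))).dpairs,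
        ‖grad ((F.P K).eta (K - n)) q.2.1 (fun y => A ⟨y, q.2.2⟩) q.1‖ < κ * ε (K - n)) ∧
      (∀ b ∈ Sect2.bondsDeep (cover (F.P K) '' box (F.P K).L (cornerP (F.P K) Mc ρ idx) (sideP (F.P K) Mc ρ) (K - n)),
        ‖Sect2.codiffCurlA ((F.P K).eta (K - n)) A b.src b.dir‖ < κ * ε (K - n)) ∧
      (∀ b ∈ Sect2.bondsDeep (cover (F.P K) '' box (F.P K).L (cornerP (F.P K) Mc ρ idx) (sideP (F.P K) Mc ρ) (K - n)),
        ‖∑ ν' : Fin (F.P K).d, (((F.P K).eta (K - n) : ℝ) : ℂ)⁻¹ •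
            (grad ((F.P K).eta (K - n)) ν' (fun y => A ⟨y, b.dir⟩) (b.src.unshift ν') - grad ((F.P K).eta (K - n)) ν' (fun y => A ⟨y, b.dir⟩) b.src)‖ <
          κ * ε (K - n)) ∧
      (∀ D' : Domains (F.P K), LinearMap.ker (QpE D') ≤
          LinearMap.ker (QpE (domainsMeet (cubeDomains (F.P K) (cornerP (F.P K) Mc ρ idx) (sideP (F.P K) Mc ρ) ρ (K - n) hk) (domainsOfSeq s.Ω (K - n) hk))) →
        ∀ φ : MatA N →L[ℂ] ℂ,
        RE D' ((F.P K).eta (K - n))⁻¹ (dsE ((F.P K).eta (K - n))⁻¹ (WithLp.toLp 2 fun b => (φ (A b)).re : BondSpace (F.P K))) = 0 ∧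
        RE D' ((F.P K).eta (K - n))⁻¹ (dsE ((F.P K).eta (K - n))⁻¹ (WithLp.toLp 2 fun b => (φ (A b)).im : BondSpace (F.P K))) = 0) ∧
      NrmSymPhiOfRecord F N Mc ρ ψ ν M g K k s U (K - n) idx u A := by
  intro ν M g K k s hsep hM₁ hadm hk1 ε δ hδ _ _ hεr hcomp _ W _ U h17 h19 _ _ n hk hn1 hnk idx hdat _
  obtain ⟨hcν, hlevF⟩ := hAdm ν M g K k s hadm
  have hfl : (11 * 4 + 4 * ρ + Mc + 3) * F.L ≤ ν.M₁ := hc.trans hcν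
  have hlevP : k + c₀ ≤ (F.P K).m + (F.P K).K := by rw [T4Family.P_m, T4Family.P_K]; exact hlevF
  have hlev : Mc + 11 * 4 + 6 * ρ ≤ (F.P K).sitesPerDir k := by
    refine hc₀.trans ?_
    have := two_mul_pow_le_sitesPerDir_of_levelGuard (P := F.P K) le_rfl hlevP
    rwa [T4Family.P_L] at this
  have hε : ∀ m, m ≤ k → 0 < ε m ∧ ε m ≤ a₀ := fun m hm =>
    ⟨lt_of_lt_of_le (mul_pos hB₃ (hδ m hm).1) (hεr m hm).1, (hεr m hm).2⟩
  obtain ⟨u, A, h1, hT1, hT2, hT2b, h2, h3, h4, h5, h6, hN⟩ := hT hκ ν M g K k s hsep hM₁ hfl hlev hk1 ε hε hcomp U h17 h19 (K - n) hk hn1 hnk idx hdat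
  exact ⟨u, A, h1, hT1, hT2, hT2b, h2, h3, h4, h5, fun D' hD' φ => ⟨RE_eq_zero_of_ker_le hD' (h6 φ).1, RE_eq_zero_of_ker_le hD' (h6 φ).2⟩, hN⟩

/-! ## §4  A6 certificate: the premise's conclusion is inhabited at the trivial field -/

variable {F N}

/-- ★ **A6 CERTIFICATE FOR `NrmSymPhiOfRecord` AT THE TRIVIAL FIELD** (`0 ≤ ψ`): from ✓p741711's exact certificate `nrmSymOfRecord_one`. [cite: Balaban1987RG1, (0.11) p.253; Balaban1985Averaging, (79)–(81) p.30 (bookkeeping)] -/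
theorem nrmSymPhiOfRecord_one (Mc ρ : ℕ) {ψ : ℝ} (hψ : 0 ≤ ψ) (ν : Stage7Numerics) (M : ℕ) (g : ℕ → ℝ) (K k : ℕ) (s : SeqOfRecord F ν M g K k) (j : ℕ) (idx : Pt (F.P K).d)
    (A : PBond (F.P K) 0 → MatA N) :
    NrmSymPhiOfRecord F N Mc ρ ψ ν M g K k s (1 : GaugeField (F.P K) 0 (SU N)) j idx (fun _ => 1 : GaugeTransf (F.P K) 0 (SU N)) A :=
  NrmSymPhiOfRecord.of_exact hψ (nrmSymOfRecord_one Mc ρ ν M g K k s j idx A)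

/-- ★ **A6 CERTIFICATE FOR `HThm4RecSym152Phi`'s CONCLUSION AT THE TRIVIAL FIELD** (`κ > 0`, `ε_j > 0`, `ψ ≥ 0`): the ∃-clause at `U := 1` holds with `u := 1`, `A := 0` — ✓p741711's certificate with
row 9′ relaxed.  (The premise itself is NOT proved by this.) [cite: Balaban1985Variational, (152)–(153) p.301 (bookkeeping); Balaban1985RegularSpaces, (1.38) p.82] -/
theorem hThm4RecSym152Phi_conclusion_at_one (Mc ρ : ℕ) {κ ψ : ℝ} (hκ : 0 < κ) (hψ : 0 ≤ ψ) (ν : Stage7Numerics) (M : ℕ) (g : ℕ → ℝ) (K k : ℕ) (s : SeqOfRecord F ν M g K k)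
    {ε : ℕ → ℝ} (j : ℕ) (hk : j ≤ (F.P K).m + (F.P K).K) (idx : Pt (F.P K).d) (hε : 0 < ε j) :
    ∃ (u : GaugeTransf (F.P K) 0 (SU N)) (A : PBond (F.P K) 0 → MatA N),
      (∀ b ∈ (Sect2.regionOfSet (F.P K) (cover (F.P K) '' box (F.P K).L (cornerP (F.P K) Mc ρ idx) (sideP (F.P K) Mc ρ) j)).bonds,
        gaugeU (fun x => ιSU N (u x)) (fun b' => ιSU N ((1 : GaugeField (F.P K) 0 (SU N)) b')) b = expI ((F.P K).eta j) (A b)) ∧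
      (∀ b ∈ (Sect2.regionOfSet (F.P K) (cover (F.P K) '' cube (F.P K).L (cornerP (F.P K) Mc ρ idx) (sideP (F.P K) Mc ρ) ρ j 0)).bonds,
        gaugeU (fun x => ιSU N (u x)) (fun b' => ιSU N ((1 : GaugeField (F.P K) 0 (SU N)) b')) b = expI ((F.P K).eta j) (A b)) ∧
      (∀ j', j' ≤ j →
        ∀ b ∈ (Sect2.regionOfSet (F.P K) (cover (F.P K) '' cube (F.P K).L (cornerP (F.P K) Mc ρ idx) (sideP (F.P K) Mc ρ) ρ j j')).bonds,
          ‖A b‖ < κ * ε j * ((F.P K).L : ℝ) ^ (j - j')) ∧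
      (∀ j', j' ≤ j →
        ∀ q ∈ (Sect2.regionOfSet (F.P K) (cover (F.P K) '' cube (F.P K).L (cornerP (F.P K) Mc ρ idx) (sideP (F.P K) Mc ρ) ρ j j')).dpairs,
          ‖grad ((F.P K).eta j) q.2.1 (fun y => A ⟨y, q.2.2⟩) q.1‖ < κ * ε j * ((F.P K).L : ℝ) ^ (2 * (j - j'))) ∧
      (∀ b ∈ (Sect2.regionOfSet (F.P K) (cover (F.P K) '' box (F.P K).L (cornerP (F.P K) Mc ρ idx) (sideP (F.P K) Mc ρ) j)).bonds,
        ‖A b‖ < κ * ε j) ∧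
      (∀ q ∈ (Sect2.regionOfSet (F.P K) (cover (F.P K) '' box (F.P K).L (cornerP (F.P K) Mc ρ idx) (sideP (F.P K) Mc ρ) j)).dpairs,
        ‖grad ((F.P K).eta j) q.2.1 (fun y => A ⟨y, q.2.2⟩) q.1‖ < κ * ε j) ∧
      (∀ b ∈ Sect2.bondsDeep (cover (F.P K) '' box (F.P K).L (cornerP (F.P K) Mc ρ idx) (sideP (F.P K) Mc ρ) j),
        ‖Sect2.codiffCurlA ((F.P K).eta j) A b.src b.dir‖ < κ * ε j) ∧
      (∀ b ∈ Sect2.bondsDeep (cover (F.P K) '' box (F.P K).L (cornerP (F.P K) Mc ρ idx) (sideP (F.P K) Mc ρ) j),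
        ‖∑ ν' : Fin (F.P K).d, (((F.P K).eta j : ℝ) : ℂ)⁻¹ •
            (grad ((F.P K).eta j) ν' (fun y => A ⟨y, b.dir⟩) (b.src.unshift ν') - grad ((F.P K).eta j) ν' (fun y => A ⟨y, b.dir⟩) b.src)‖ < κ * ε j) ∧
      (∀ φ : MatA N →L[ℂ] ℂ,
        RE (domainsMeet (cubeDomains (F.P K) (cornerP (F.P K) Mc ρ idx) (sideP (F.P K) Mc ρ) ρ j hk) (domainsOfSeq s.Ω j hk)) ((F.P K).eta j)⁻¹
            (dsE ((F.P K).eta j)⁻¹ (WithLp.toLp 2 fun b => (φ (A b)).re : BondSpace (F.P K))) = 0 ∧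
        RE (domainsMeet (cubeDomains (F.P K) (cornerP (F.P K) Mc ρ idx) (sideP (F.P K) Mc ρ) ρ j hk) (domainsOfSeq s.Ω j hk)) ((F.P K).eta j)⁻¹
            (dsE ((F.P K).eta j)⁻¹ (WithLp.toLp 2 fun b => (φ (A b)).im : BondSpace (F.P K))) = 0) ∧
      NrmSymPhiOfRecord F N Mc ρ ψ ν M g K k s (1 : GaugeField (F.P K) 0 (SU N)) j idx u A := by
  obtain ⟨u, A, h1, h2, h3, h4, h5, h6, h7, h8, h9, hN⟩ := hThm4RecSym152_conclusion_at_one (N := N) Mc ρ hκ ν M g K k s j hk idx hε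
  exact ⟨u, A, h1, h2, h3, h4, h5, h6, h7, h8, h9, NrmSymPhiOfRecord.of_exact hψ hN⟩

end Summit.QuantumFields.YangMills.BalabanUVNodes.N07Thm4RecordStructureSym152Phi

end
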